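import Mathlib.MeasureTheory.Integral.Marginal
import Mathlib.MeasureTheory.Integral.Pi
import HarnessLib

/-!
# Window densities of a two-sided stationary Markov chain built from a transfer kernel

Topic `Literature/Probability/LatticeModels`; theorems only (no definitions, no named facts).

This is the finite-dimensional bookkeeping behind the classical construction of one-dimensional
infinite-volume Gibbs states as stationary Markov chains (Georgii 2011, Ch. 10–11, esp. Thm 10.25 /
§11.1 "Markov chains with continuous state space"; Spitzer 1971; for unbounded-spin chains with a
strictly positive Hilbert–Schmidt transfer kernel: Cassandro–Olivieri–Pellegrinotti–Presutti,
Z. Wahrsch. 41 (1978) §2). Data, all on a measurable space `S` with a σ-finite a priori measure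
`ν`: a jointly measurable symmetric kernel `k : S → S → ℝ≥0∞`, a one-site weight `w : S → ℝ≥0∞`, an
everywhere-defined eigenfunction `φ : S → ℝ≥0∞` and an eigenvalue `L ∈ (0, ∞)` with
`∫ k(z, y) φ(y) w(y) dν(y) = L φ(z)` for EVERY `z` and `∫ φ² w dν = 1`
(`Literature.Analysis.OperatorTheory.exists_pointwise_eigenfunction_lintegral` produces them for
bounded strictly positive kernels). The law of the chain on the window `{a, …, a+n} ⊆ ℤ` has
density (w.r.t. `ν^{⊗(n+1)}`)

  `D a n σ = φ(σ_a) φ(σ_{a+n}) ∏_{j<n} (k(σ_{a+j}, σ_{a+j+1}) L⁻¹) ∏_{j≤n} w(σ_{a+j})`.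

To avoid introducing a definition, `D : ℤ → ℕ → (ℤ → S) → ℝ≥0∞` is a VARIABLE constrained by the
hypothesis `hD : ∀ a n σ, D a n σ = …` (instantiate with the lambda and `fun _ _ _ => rfl`).
All integrals over finitely many coordinates are Mathlib marginal integrals `∫⋯∫⁻_s, f ∂ν`
(`MeasureTheory.lmarginal`) on the full configuration space `ℤ → S`.

* `measurable_D`, `dependsOn_D` — measurability; `D a n` depends only on the window;
* `lmarginal_right_D` / `lmarginal_left_D` — integrating out the site `a+n+1` of `D a (n+1)`
  gives `D a n`; integrating out the site `a` gives `D (a+1) n` (eigen-equation and symmetry);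
* `lmarginal_sdiff_D` — **consistency**: for a window inside a larger one, integrating the larger
  density over the extra sites returns the smaller density;
* `lmarginal_D_eq_one` — **normalisation** `∫⋯∫⁻ D a n = 1`;
* `lmarginal_window_reduction` — for `Φ` depending only on the smaller window,
  `∫⋯∫⁻_{big} Φ D_{big} = ∫⋯∫⁻_{small} Φ D_{small}`;
* `lmarginal_eq_of_dependsOn`, `lmarginal_mul_left_of_dependsOn'` — marginal-integral helpers.

[cite: Georgii2011, Thm 10.25 and §11.1]
-/

noncomputable section

open MeasureTheory Set Function Finset
open scoped ENNReal

namespace Literature.Probability.LatticeModels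

variable {S : Type*} [MeasurableSpace S] {ν : Measure S}

/-! ### Marginal-integral helpers -/

omit [MeasurableSpace S] in
/-- A function of the configuration depending only on the coordinates in `s` takes the same value
on `updateFinset x s z` and `updateFinset y s z`. [folklore] -/
theorem dependsOn_apply_updateFinset_eq {f : (ℤ → S) → ℝ≥0∞} {s : Finset ℤ}
    (hf : DependsOn f (↑s : Set ℤ)) (x y : ℤ → S) (z : ↥s → S) :
    f (updateFinset x s z) = f (updateFinset y s z) :=
  hf fun i hi => by simp [updateFinset, Finset.mem_coe.1 hi]

/-- A marginal integral over `s` of a function depending only on the coordinates in `s` is a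
constant function. [folklore] -/
theorem lmarginal_eq_of_dependsOn {f : (ℤ → S) → ℝ≥0∞} {s : Finset ℤ}
    (hf : DependsOn f (↑s : Set ℤ)) (x y : ℤ → S) :
    (∫⋯∫⁻_s, f ∂fun _ : ℤ => ν) x = (∫⋯∫⁻_s, f ∂fun _ : ℤ => ν) y := by
  unfold lmarginal
  exact lintegral_congr fun z => dependsOn_apply_updateFinset_eq hf x y z

/-- A factor depending only on coordinates OFF `s` can be pulled out of a marginal integral over
`s` (variant of the tree's `lmarginal_mul_left_of_dependsOn` with the dependence set given as a
disjoint finset). [folklore] -/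
theorem lmarginal_mul_left_of_dependsOn' {g f : (ℤ → S) → ℝ≥0∞} {s t : Finset ℤ}
    (hg : DependsOn g (↑t : Set ℤ)) (hst : Disjoint s t) (hf : Measurable f) (x : ℤ → S) :
    (∫⋯∫⁻_s, (fun σ => g σ * f σ) ∂fun _ : ℤ => ν) x =
      g x * (∫⋯∫⁻_s, f ∂fun _ : ℤ => ν) x := by
  have hgx : ∀ ζ : ↥s → S, g (updateFinset x s ζ) = g x := fun ζ =>
    hg fun i hi => by
      have hi' : i ∉ s := fun his =>
        Finset.disjoint_left.1 hst his (Finset.mem_coe.1 hi)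
      simp [updateFinset, hi']
  simp only [lmarginal, hgx]
  exact lintegral_const_mul _ (hf.comp measurable_updateFinset)

/-- Product version: a factor depending only on coordinates off `s` can be pulled out on the
right. [folklore] -/
theorem lmarginal_mul_right_of_dependsOn' {g f : (ℤ → S) → ℝ≥0∞} {s t : Finset ℤ}
    (hg : DependsOn g (↑t : Set ℤ)) (hst : Disjoint s t) (hf : Measurable f) (x : ℤ → S) :
    (∫⋯∫⁻_s, (fun σ => f σ * g σ) ∂fun _ : ℤ => ν) x =
      (∫⋯∫⁻_s, f ∂fun _ : ℤ => ν) x * g x := by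
  have h := lmarginal_mul_left_of_dependsOn' (ν := ν) hg hst hf x
  simp only [mul_comm (g _)] at h
  simpa only [mul_comm] using h

/-! ### The window densities -/

section Window

variable {k : S → S → ℝ≥0∞} {φ w : S → ℝ≥0∞} {L : ℝ≥0∞} {D : ℤ → ℕ → (ℤ → S) → ℝ≥0∞}

/-- Coordinate evaluation composed with a measurable function of one site is measurable. [folklore] -/
theorem measurable_comp_eval {g : S → ℝ≥0∞} (hg : Measurable g) (i : ℤ) :
    Measurable fun σ : ℤ → S => g (σ i) :=
  hg.comp (measurable_pi_apply i)

/-- A jointly measurable kernel evaluated at two coordinates is measurable. [folklore] -/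
theorem measurable_kernel_eval (hk : Measurable (uncurry k)) (i j : ℤ) :
    Measurable fun σ : ℤ → S => k (σ i) (σ j) := by
  have : (fun σ : ℤ → S => k (σ i) (σ j)) = uncurry k ∘ fun σ => (σ i, σ j) := rfl
  rw [this]
  exact hk.comp ((measurable_pi_apply i).prodMk (measurable_pi_apply j))

/-- **Measurability of the window densities.** [folklore] -/
theorem measurable_D (hk : Measurable (uncurry k)) (hφ : Measurable φ) (hw : Measurable w)
    (hD : ∀ a n σ, D a n σ = φ (σ a) * φ (σ (a + n)) *
      (∏ j ∈ Finset.range n, k (σ (a + j)) (σ (a + j + 1)) * L⁻¹) *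
      ∏ j ∈ Finset.range (n + 1), w (σ (a + j)))
    (a : ℤ) (n : ℕ) : Measurable (D a n) := by
  have h : D a n = fun σ => φ (σ a) * φ (σ (a + n)) *
      (∏ j ∈ Finset.range n, k (σ (a + j)) (σ (a + j + 1)) * L⁻¹) *
      ∏ j ∈ Finset.range (n + 1), w (σ (a + j)) := funext (hD a n)
  rw [h]
  refine (((measurable_comp_eval hφ a).mul (measurable_comp_eval hφ _)).mul
    (Finset.measurable_prod _ fun j _ => (measurable_kernel_eval hk _ _).mul_const _)).mul
    (Finset.measurable_prod _ fun j _ => measurable_comp_eval hw _)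

omit [MeasurableSpace S] in
/-- **The window density depends only on the window** `{a, …, a+n}`. [folklore] -/
theorem dependsOn_D
    (hD : ∀ a n σ, D a n σ = φ (σ a) * φ (σ (a + n)) *
      (∏ j ∈ Finset.range n, k (σ (a + j)) (σ (a + j + 1)) * L⁻¹) *
      ∏ j ∈ Finset.range (n + 1), w (σ (a + j)))
    (a : ℤ) (n : ℕ) : DependsOn (D a n) (↑(Finset.Icc a (a + n)) : Set ℤ) := by
  intro x y hxy
  simp only [Finset.coe_Icc, Set.mem_Icc] at hxy
  rw [hD, hD]
  have ha : x a = y a := hxy a ⟨le_rfl, by omega⟩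
  have hb : x (a + n) = y (a + n) := hxy (a + n) ⟨by omega, le_rfl⟩
  rw [ha, hb]
  congr 1
  · congr 1
    refine Finset.prod_congr rfl fun j hj => ?_
    rw [Finset.mem_range] at hj
    rw [hxy (a + j) ⟨by omega, by omega⟩, hxy (a + j + 1) ⟨by omega, by omega⟩]
  · refine Finset.prod_congr rfl fun j hj => ?_
    rw [Finset.mem_range] at hj
    rw [hxy (a + j) ⟨by omega, by omega⟩]

/-- **Right step**: integrating the density of the window `{a, …, a+n+1}` over the last site
returns the density of `{a, …, a+n}` — the eigen-equation `∫ k(z,y) φ(y) w(y) dν(y) = L φ(z)`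
at `z = σ_{a+n}`. [cite: Georgii2011, Thm 10.25 and §11.1] -/
theorem lmarginal_right_D (hk : Measurable (uncurry k)) (hφ : Measurable φ) (hw : Measurable w)
    (hL0 : L ≠ 0) (hLt : L ≠ ∞)
    (heig : ∀ z, ∫⁻ y, k z y * φ y * w y ∂ν = L * φ z)
    (hD : ∀ a n σ, D a n σ = φ (σ a) * φ (σ (a + n)) *
      (∏ j ∈ Finset.range n, k (σ (a + j)) (σ (a + j + 1)) * L⁻¹) *
      ∏ j ∈ Finset.range (n + 1), w (σ (a + j)))
    (a : ℤ) (n : ℕ) (σ : ℤ → S) :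
    (∫⋯∫⁻_{a + n + 1}, D a (n + 1) ∂fun _ : ℤ => ν) σ = D a n σ := by
  rw [lmarginal_singleton]
  dsimp only
  -- evaluate the density on the updated configuration
  have hval : ∀ y : S, D a (n + 1) (Function.update σ (a + n + 1) y) =
      (φ (σ a) * (∏ j ∈ Finset.range n, k (σ (a + j)) (σ (a + j + 1)) * L⁻¹) *
        (∏ j ∈ Finset.range (n + 1), w (σ (a + j))) * L⁻¹) * (k (σ (a + n)) y * φ y * w y) := by
    intro y
    rw [hD]
    have h1 : Function.update σ (a + n + 1) y a = σ a :=
      Function.update_of_ne (by omega) _ _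
    have h2 : Function.update σ (a + n + 1) y (a + ↑(n + 1)) = y := by
      rw [show a + ((n + 1 : ℕ) : ℤ) = a + n + 1 by push_cast; ring]
      exact Function.update_self _ _ _
    have h3 : ∏ j ∈ Finset.range (n + 1),
        k (Function.update σ (a + n + 1) y (a + j)) (Function.update σ (a + n + 1) y (a + j + 1)) * L⁻¹ =
        (∏ j ∈ Finset.range n, k (σ (a + j)) (σ (a + j + 1)) * L⁻¹) * (k (σ (a + n)) y * L⁻¹) := by
      rw [Finset.prod_range_succ]
      congr 1
      · refine Finset.prod_congr rfl fun j hj => ?_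
        rw [Finset.mem_range] at hj
        rw [Function.update_of_ne (by omega), Function.update_of_ne (by omega)]
      · rw [Function.update_of_ne (by omega), Function.update_self]
    have h4 : ∏ j ∈ Finset.range (n + 1 + 1), w (Function.update σ (a + n + 1) y (a + j)) =
        (∏ j ∈ Finset.range (n + 1), w (σ (a + j))) * w y := by
      rw [Finset.prod_range_succ]
      congr 1
      · refine Finset.prod_congr rfl fun j hj => ?_
        rw [Finset.mem_range] at hj
        rw [Function.update_of_ne (by omega)]
      · rw [show a + ((n + 1 : ℕ) : ℤ) = a + n + 1 by push_cast; ring, Function.update_self]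
    rw [h1, h2, h3, h4]
    ring
  simp_rw [hval]
  have hmeas : Measurable fun y => k (σ (a + n)) y * φ y * w y :=
    ((hk.of_uncurry_left.mul hφ).mul hw)
  rw [lintegral_const_mul _ hmeas, heig, hD]
  have hLL : L⁻¹ * L = 1 := ENNReal.inv_mul_cancel hL0 hLt
  calc φ (σ a) * (∏ j ∈ Finset.range n, k (σ (a + j)) (σ (a + j + 1)) * L⁻¹) *
        (∏ j ∈ Finset.range (n + 1), w (σ (a + j))) * L⁻¹ * (L * φ (σ (a + n)))
      = φ (σ a) * φ (σ (a + n)) * (∏ j ∈ Finset.range n, k (σ (a + j)) (σ (a + j + 1)) * L⁻¹) *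
        (∏ j ∈ Finset.range (n + 1), w (σ (a + j))) * (L⁻¹ * L) := by ring
    _ = _ := by rw [hLL, mul_one]

/-- **Left step**: integrating the density of the window `{a, …, a+n+1}` over the FIRST site
returns the density of `{a+1, …, a+n+1}` — symmetry of `k` and the eigen-equation at
`z = σ_{a+1}`. [cite: Georgii2011, Thm 10.25 and §11.1] -/
theorem lmarginal_left_D (hk : Measurable (uncurry k)) (hφ : Measurable φ) (hw : Measurable w)
    (hL0 : L ≠ 0) (hLt : L ≠ ∞)
    (heig : ∀ z, ∫⁻ y, k z y * φ y * w y ∂ν = L * φ z) (hsym : ∀ z y, k z y = k y z)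
    (hD : ∀ a n σ, D a n σ = φ (σ a) * φ (σ (a + n)) *
      (∏ j ∈ Finset.range n, k (σ (a + j)) (σ (a + j + 1)) * L⁻¹) *
      ∏ j ∈ Finset.range (n + 1), w (σ (a + j)))
    (a : ℤ) (n : ℕ) (σ : ℤ → S) :
    (∫⋯∫⁻_{a}, D a (n + 1) ∂fun _ : ℤ => ν) σ = D (a + 1) n σ := by
  rw [lmarginal_singleton]
  dsimp only
  have hval : ∀ y : S, D a (n + 1) (Function.update σ a y) =
      (φ (σ (a + 1 + n)) * (∏ j ∈ Finset.range n, k (σ (a + 1 + j)) (σ (a + 1 + j + 1)) * L⁻¹) *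
        (∏ j ∈ Finset.range (n + 1), w (σ (a + 1 + j))) * L⁻¹) *
        (k (σ (a + 1)) y * φ y * w y) := by
    intro y
    rw [hD]
    have h1 : Function.update σ a y a = y := Function.update_self _ _ _
    have h2 : Function.update σ a y (a + ↑(n + 1)) = σ (a + 1 + n) := by
      rw [Function.update_of_ne (by push_cast; omega)]
      congr 1; push_cast; ring
    have h3 : ∏ j ∈ Finset.range (n + 1),
        k (Function.update σ a y (a + j)) (Function.update σ a y (a + j + 1)) * L⁻¹ =
        (∏ j ∈ Finset.range n, k (σ (a + 1 + j)) (σ (a + 1 + j + 1)) * L⁻¹) *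
          (k (σ (a + 1)) y * L⁻¹) := by
      rw [Finset.prod_range_succ']
      congr 1
      · refine Finset.prod_congr rfl fun j hj => ?_
        rw [Function.update_of_ne (by push_cast; omega), Function.update_of_ne (by push_cast; omega)]
        congr 3 <;> push_cast <;> ring
      · rw [show a + ((0 : ℕ) : ℤ) = a by simp, Function.update_self,
          Function.update_of_ne (by omega), hsym]
    have h4 : ∏ j ∈ Finset.range (n + 1 + 1), w (Function.update σ a y (a + j)) =
        (∏ j ∈ Finset.range (n + 1), w (σ (a + 1 + j))) * w y := by
      rw [Finset.prod_range_succ']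
      congr 1
      · refine Finset.prod_congr rfl fun j hj => ?_
        rw [Function.update_of_ne (by push_cast; omega)]
        congr 2; push_cast; ring
      · rw [show a + ((0 : ℕ) : ℤ) = a by simp, Function.update_self]
    rw [h1, h2, h3, h4]
    ring
  simp_rw [hval]
  have hmeas : Measurable fun y => k (σ (a + 1)) y * φ y * w y :=
    ((hk.of_uncurry_left.mul hφ).mul hw)
  rw [lintegral_const_mul _ hmeas, heig, hD]
  have hLL : L⁻¹ * L = 1 := ENNReal.inv_mul_cancel hL0 hLt
  calc φ (σ (a + 1 + n)) * (∏ j ∈ Finset.range n, k (σ (a + 1 + j)) (σ (a + 1 + j + 1)) * L⁻¹) *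
        (∏ j ∈ Finset.range (n + 1), w (σ (a + 1 + j))) * L⁻¹ * (L * φ (σ (a + 1)))
      = φ (σ (a + 1)) * φ (σ (a + 1 + n)) *
        (∏ j ∈ Finset.range n, k (σ (a + 1 + j)) (σ (a + 1 + j + 1)) * L⁻¹) *
        (∏ j ∈ Finset.range (n + 1), w (σ (a + 1 + j))) * (L⁻¹ * L) := by ring
    _ = _ := by rw [hLL, mul_one]

/-- **Consistency of the window densities**: for `a' ≤ a` and `a + n ≤ a' + n'`, integrating the
density of the window `{a', …, a'+n'}` over the sites outside `{a, …, a+n}` returns the density of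
the smaller window. [cite: Georgii2011, Thm 10.25 and §11.1] -/
theorem lmarginal_sdiff_D [SigmaFinite ν] (hk : Measurable (uncurry k)) (hφ : Measurable φ)
    (hw : Measurable w) (hL0 : L ≠ 0) (hLt : L ≠ ∞)
    (heig : ∀ z, ∫⁻ y, k z y * φ y * w y ∂ν = L * φ z) (hsym : ∀ z y, k z y = k y z)
    (hD : ∀ a n σ, D a n σ = φ (σ a) * φ (σ (a + n)) *
      (∏ j ∈ Finset.range n, k (σ (a + j)) (σ (a + j + 1)) * L⁻¹) *
      ∏ j ∈ Finset.range (n + 1), w (σ (a + j)))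
    {a a' : ℤ} {n n' : ℕ} (ha : a' ≤ a) (hb : a + n ≤ a' + n') :
    (∫⋯∫⁻_Finset.Icc a' (a' + n') \ Finset.Icc a (a + n), D a' n' ∂fun _ : ℤ => ν) = D a n := by
  classical
  -- induction on the number `d = n' - n` of extra sites, generalising the left end `a'`
  obtain ⟨d, rfl⟩ : ∃ d : ℕ, n' = n + d := ⟨n' - n, by omega⟩
  induction d generalizing a' with
  | zero =>
    have haa : a' = a := le_antisymm ha (by push_cast at hb; omega)
    subst haa
    rw [Nat.add_zero, Finset.sdiff_self, lmarginal_empty]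
  | succ d ih =>
    rcases eq_or_lt_of_le ha with rfl | hlt
    · -- peel the rightmost site `a + n + d + 1`
      have hset : Finset.Icc a' (a' + ↑(n + (d + 1))) \ Finset.Icc a' (a' + n) =
          insert (a' + ↑(n + d) + 1) (Finset.Icc a' (a' + ↑(n + d)) \ Finset.Icc a' (a' + n)) := by
        ext i
        simp only [Finset.mem_sdiff, Finset.mem_Icc, Finset.mem_insert]
        push_cast
        omega
      have hnot : a' + ↑(n + d) + 1 ∉ Finset.Icc a' (a' + ↑(n + d)) \ Finset.Icc a' (a' + n) := by
        simp only [Finset.mem_sdiff, Finset.mem_Icc]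
        push_cast
        omega
      rw [hset, lmarginal_insert' _ (measurable_D hk hφ hw hD _ _) hnot,
        show (n + (d + 1)) = (n + d) + 1 by ring]
      have hfun : (fun x : ℤ → S => ∫⁻ y, D a' (n + d + 1) (Function.update x (a' + ↑(n + d) + 1) y) ∂ν) =
          D a' (n + d) := by
        funext σ
        have h := lmarginal_right_D (ν := ν) hk hφ hw hL0 hLt heig hD a' (n + d) σ
        rwa [lmarginal_singleton] at h
      rw [hfun]
      exact ih le_rfl (by push_cast; omega)
    · -- peel the leftmost site `a'`
      have hset : Finset.Icc a' (a' + ↑(n + (d + 1))) \ Finset.Icc a (a + n) =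
          insert a' (Finset.Icc (a' + 1) (a' + 1 + ↑(n + d)) \ Finset.Icc a (a + n)) := by
        ext i
        simp only [Finset.mem_sdiff, Finset.mem_Icc, Finset.mem_insert]
        push_cast
        omega
      have hnot : a' ∉ Finset.Icc (a' + 1) (a' + 1 + ↑(n + d)) \ Finset.Icc a (a + n) := by
        simp only [Finset.mem_sdiff, Finset.mem_Icc]
        push_cast
        omega
      rw [hset, lmarginal_insert' _ (measurable_D hk hφ hw hD _ _) hnot,
        show (n + (d + 1)) = (n + d) + 1 by ring]
      have hfun : (fun x : ℤ → S => ∫⁻ y, D a' (n + d + 1) (Function.update x a' y) ∂ν) =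
          D (a' + 1) (n + d) := by
        funext σ
        have h := lmarginal_left_D (ν := ν) hk hφ hw hL0 hLt heig hsym hD a' (n + d) σ
        rwa [lmarginal_singleton] at h
      rw [hfun]
      exact ih (by omega) (by push_cast at hb ⊢; omega)

/-- **Normalisation of the window densities**: `∫⋯∫⁻_{a,…,a+n} D a n = 1` (reduce to the single
site `a`, where `D a 0 σ = φ(σ_a)² w(σ_a)` integrates to `1`). [cite: Georgii2011, Thm 10.25 and §11.1] -/
theorem lmarginal_D_eq_one [SigmaFinite ν] (hk : Measurable (uncurry k)) (hφ : Measurable φ)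
    (hw : Measurable w) (hL0 : L ≠ 0) (hLt : L ≠ ∞)
    (heig : ∀ z, ∫⁻ y, k z y * φ y * w y ∂ν = L * φ z) (hsym : ∀ z y, k z y = k y z)
    (hnorm : ∫⁻ y, φ y ^ 2 * w y ∂ν = 1)
    (hD : ∀ a n σ, D a n σ = φ (σ a) * φ (σ (a + n)) *
      (∏ j ∈ Finset.range n, k (σ (a + j)) (σ (a + j + 1)) * L⁻¹) *
      ∏ j ∈ Finset.range (n + 1), w (σ (a + j)))
    (a : ℤ) (n : ℕ) (σ : ℤ → S) :
    (∫⋯∫⁻_Finset.Icc a (a + n), D a n ∂fun _ : ℤ => ν) σ = 1 := by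
  classical
  have hset : Finset.Icc a (a + n) = {a} ∪ (Finset.Icc a (a + n) \ Finset.Icc a (a + ↑(0 : ℕ))) := by
    ext i
    simp only [Finset.mem_union, Finset.mem_singleton, Finset.mem_sdiff, Finset.mem_Icc]
    push_cast
    omega
  have hdisj : Disjoint ({a} : Finset ℤ) (Finset.Icc a (a + n) \ Finset.Icc a (a + ↑(0 : ℕ))) := by
    rw [Finset.disjoint_singleton_left]
    simp only [Finset.mem_sdiff, Finset.mem_Icc]
    push_cast
    omega
  rw [hset, lmarginal_union _ _ (measurable_D hk hφ hw hD a n) hdisj,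
    lmarginal_sdiff_D hk hφ hw hL0 hLt heig hsym hD le_rfl (by push_cast; omega),
    lmarginal_singleton]
  dsimp only
  have hval : ∀ y : S, D a 0 (Function.update σ a y) = φ y ^ 2 * w y := by
    intro y
    rw [hD]
    simp [sq]
  simp_rw [hval]
  exact hnorm

/-- **Window reduction**: if `Φ` depends only on the coordinates in the window `{a, …, a+n}`,
which lies inside `{a', …, a'+n'}`, then
`∫⋯∫⁻_{a',…,a'+n'} Φ · D a' n' = ∫⋯∫⁻_{a,…,a+n} Φ · D a n`. [cite: Georgii2011, Thm 10.25 and §11.1] -/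
theorem lmarginal_window_reduction [SigmaFinite ν] (hk : Measurable (uncurry k))
    (hφ : Measurable φ) (hw : Measurable w) (hL0 : L ≠ 0) (hLt : L ≠ ∞)
    (heig : ∀ z, ∫⁻ y, k z y * φ y * w y ∂ν = L * φ z) (hsym : ∀ z y, k z y = k y z)
    (hD : ∀ a n σ, D a n σ = φ (σ a) * φ (σ (a + n)) *
      (∏ j ∈ Finset.range n, k (σ (a + j)) (σ (a + j + 1)) * L⁻¹) *
      ∏ j ∈ Finset.range (n + 1), w (σ (a + j)))
    {a a' : ℤ} {n n' : ℕ} (ha : a' ≤ a) (hb : a + n ≤ a' + n')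
    {Φ : (ℤ → S) → ℝ≥0∞} (hΦm : Measurable Φ) (hΦd : DependsOn Φ (↑(Finset.Icc a (a + n)) : Set ℤ)) :
    (∫⋯∫⁻_Finset.Icc a' (a' + n'), (fun σ => Φ σ * D a' n' σ) ∂fun _ : ℤ => ν) =
      ∫⋯∫⁻_Finset.Icc a (a + n), (fun σ => Φ σ * D a n σ) ∂fun _ : ℤ => ν := by
  classical
  have hsub : Finset.Icc a (a + n) ⊆ Finset.Icc a' (a' + n') := fun i hi => by
    simp only [Finset.mem_Icc] at hi ⊢; omega
  rw [← Finset.union_sdiff_of_subset hsub,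
    lmarginal_union _ (fun σ => Φ σ * D a' n' σ) (hΦm.mul (measurable_D hk hφ hw hD a' n'))
      Finset.disjoint_sdiff]
  congr 1
  funext x
  rw [lmarginal_mul_left_of_dependsOn' (ν := ν) hΦd Finset.sdiff_disjoint
    (measurable_D hk hφ hw hD a' n') x, lmarginal_sdiff_D hk hφ hw hL0 hLt heig hsym hD ha hb]

end Window

end Literature.Probability.LatticeModels

end
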